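/-
Copyright (c) 2026 the pub-hodgecm-mathlib formalisation cell (harness21).  Prover seat hodgecm-mathlib-LH4-p07 (g12): Track B «K2-LIT» valve hand,
hLiu418 = stmt-HodgeConjecture-24832; LEAD F0P6-plan (g15) RULING M-160f + BATCH #227 «(σ-A) mini-road, brick [A3]»; (σ-A) road desk K2Liu-p25 (g3);
second reader F0P2-p11 (g3) (ask 2026-09-05T01:30:54Z: the PAIR edition over ★ p863539 ∕ ★ p863595 §2).
-/
import Summits.HodgeConjecture.HodgeConjecture.Theorems.K2LiuRankOneStageIntegralsAtHalf   -- ★ p864232 [A3] FILE 1 (this seat): `half_re_facts`, `re_facts_of_pos_re`; brings ★ p863595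
import HarnessLib

/-!
# Crux `HLiu418`, road `K2_Liu`, #42S BLOCK D row D-2, (σ-A) brick [A3] FILE 3: THE STAGE INTEGRALS AT A SPLIT PLACE `v = w₁w₂` — stage B a TRIPLE integral, the three
# `L`-factors of (d′)(e′) cancelling against (f′)'s prefactor on `0 < re s₀` and at `s₀ = ½`

Cell `hodgecm-mathlib`, crux item hLiu418 = `stmt-HodgeConjecture-24832`; squad K2 ∕ K2Liu (L1); prover LH4-p07 (g12).  THEOREMS ONLY (no `def`, no `instance`, no
`notation`, no named-fact hypothesis, no `sorry`, default heartbeats); lane `--supports stmt-HodgeConjecture-24832 --as helper` (count-neutral helper; closes no socket).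

The split-place twin of ★ p864232 §2, over the (d′)(e′)(f′) letters of ★ `K2LiuRankOneStagePlaceLetterValues.chainValues_of_placeLetter_pair` (F0P2-p11, ★ p863595 §2;
types VERBATIM): at `v = w₁w₂` stage B is `N₂ s g = L_{E_{w₁}}(2s)⁻¹ · ∫_{ζ₁} L_{E_{w₂}}(2s)⁻¹ · ∫_{ζ₂} N₁ s (φ(w₁)·φ(u⁻(ζ₁e_{w₁} + ζ₂e_{w₂}))·g) dμ₂ dμ₁` and (f′) carries
`cN · L_F(2s₀+1) · L_{E_{w₂}}(2s₀) · L_{E_{w₁}}(2s₀)`.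
* **`stageB_eq_triple_integral_pair_of_pos_re`** ∕ **`stageB_half_eq_triple_integral_pair`** — for every `g` and `0 < re s₀` (resp. at `½`):
  `N₂ s₀ g = L_F(2s₀+1)⁻¹ · L_{E_{w₁}}(2s₀)⁻¹ · L_{E_{w₂}}(2s₀)⁻¹ · ∫_{ζ₁} ∫_{ζ₂} ∫_y f s₀ (φ(w₂)·φ(u(yδ))·(φ(w₁)·φ(u⁻(ζ₁,ζ₂))·g)) dμF dμ₂ dμ₁`;
* **`placeLetter_eq_corner_integral_pair_of_pos_re`** ∕ **`placeLetter_half_eq_corner_integral_pair`** — ONE `k₀(h)` with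
  `Gn′ s₀ h = cN · ∫_{x ∈ 𝔭^{−k}} conj ψ(σx) · ∫_{ζ₁} ∫_{ζ₂} ∫_y f s₀ (φ(w₂)·φ(u(yδ))·(φ(w₁)·φ(u⁻(ζ₁,ζ₂))·(φ(w₂)·φ(u(xδ))·h))) dμF dμ₂ dμ₁ dμF(x)` for `0 < re s₀`, `k ≥ k₀` —
  the three `L`-factors CANCEL (★ `lF_ne_zero`, ★ `lFactor_ne_zero` with ★ `norm_chiNorm_eq_one`).
NOT here: the bundled corollary over ★ `chainValues_of_placeLetter_pair`'s own binders (FILE 2 pattern, on request); the Schrödinger-model words ([A1]∕[A4]).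
HONEST LABEL.  `HC_CM` is proved only modulo the 7 printed citations (2 remaining named inputs: hLiu418 = `stmt-HodgeConjecture-24832`,
h413 = `stmt-HodgeConjecture-24833`) until rung 0 closes; count-neutral helper, closes no socket.

## References
* [HarrisKudlaSweet1996] M. Harris, S. Kudla, W. J. Sweet, J. Amer. Math. Soc. 9 (1996), §6 (6.14)–(6.16) (split places).
* [Casselman1980] W. Casselman, Compositio Math. 40 (1980), §3 Thm. 3.1.   * [KudlaRallis1994] S. Kudla, S. Rallis, Ann. of Math. 140 (1994), §2.
* [KudlaSweet1997] S. Kudla, W. J. Sweet, Israel J. Math. 98 (1997), §1.   * [Tate1950] J. Tate (1950), §2.5.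
-/

set_option autoImplicit false
set_option linter.dupNamespace false -- the mandated namespace repeats `HodgeConjecture.HodgeConjecture`

noncomputable section

namespace Summit.HodgeConjecture.HodgeConjecture.Cruxes.HLiu418.K2LiuRankOneStageIntegralsAtHalfSplit

section StageHalfSplit


open scoped Classical NNReal ENNReal ComplexConjugate
open NumberField IsDedekindDomain Matrix MeasureTheory Topology
open Literature.NumberTheory.GaloisRepresentations.IsNonarchimedeanLocalField
open Literature.NumberTheory.Automorphic Literature.NumberTheory.Automorphic.UnitaryGroup
open Literature.NumberTheory.GelbartRogawski1991.AdaptedBlocks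
open Literature.NumberTheory.GelbartRogawski1991.UnitaryDualPair.LocalSplitting
open Literature.NumberTheory.K2Lit.LocalSiegelDoubled
open Summit.HodgeConjecture.HodgeConjecture.Cruxes.HLiu418.K2LiuQRationalDefs
open Summit.HodgeConjecture.HodgeConjecture.Cruxes.HLiu418.K2LiuQRationalLFactor
open Summit.HodgeConjecture.HodgeConjecture.Cruxes.HLiu418.K2LiuLocalLFactorDefs
open Summit.HodgeConjecture.HodgeConjecture.Cruxes.HLiu418.K2LiuLocalSiegelIwasawaFrame
open Summit.HodgeConjecture.HodgeConjecture.Cruxes.HLiu418.K2LiuLocalSiegelIwasawa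
open Summit.HodgeConjecture.HodgeConjecture.Cruxes.HLiu418.K2LiuDoubledUTwoTwoBorelFrame
open Summit.HodgeConjecture.HodgeConjecture.Cruxes.HLiu418.K2LiuDoubledUTwoTwoWeylCocycle
open Summit.HodgeConjecture.HodgeConjecture.Cruxes.HLiu418.K2LiuDoubledUTwoTwoLevi
open Summit.HodgeConjecture.HodgeConjecture.Cruxes.HLiu418.K2LiuDoubledUTwoTwoFrameTransport
open Summit.HodgeConjecture.HodgeConjecture.Cruxes.HLiu418.K2LiuDoubledUTwoTwoUnipotentCoordinates
open Summit.HodgeConjecture.HodgeConjecture.Cruxes.HLiu418.K2LiuDoubledUTwoTwoUnipotentHaar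
open Summit.HodgeConjecture.HodgeConjecture.Cruxes.HLiu418.K2LiuDoubledUTwoTwoLeviTransport
open Summit.HodgeConjecture.HodgeConjecture.Cruxes.HLiu418.K2LiuUnipDeltaRankOneCoordinates
open Summit.HodgeConjecture.HodgeConjecture.Cruxes.HLiu418.K2LiuSiegelCocycleLetters
open Summit.HodgeConjecture.HodgeConjecture.Cruxes.HLiu418.K2LiuSiegelCocycleStageLetters
open Summit.HodgeConjecture.HodgeConjecture.Cruxes.HLiu418.K2LiuSiegelCocycleStageShort
open Summit.HodgeConjecture.HodgeConjecture.Cruxes.HLiu418.K2LiuSiegelCocycleChainShort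
open Summit.HodgeConjecture.HodgeConjecture.Cruxes.HLiu418.K2LiuSiegelCocycleChainLong
open Summit.HodgeConjecture.HodgeConjecture.Cruxes.HLiu418.K2LiuIteratedRankOneCocycle
open Summit.HodgeConjecture.HodgeConjecture.Cruxes.HLiu418.K2LiuSiegelIntertwiningCocycle
open Summit.HodgeConjecture.HodgeConjecture.Cruxes.HLiu418.K2LiuRankOneStage
open Summit.HodgeConjecture.HodgeConjecture.Cruxes.HLiu418.K2LiuRankOneStageTwisted
open Summit.HodgeConjecture.HodgeConjecture.Cruxes.HLiu418.K2LiuFlatSiegelFamilies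
open Summit.HodgeConjecture.HodgeConjecture.Cruxes.HLiu418.K2LiuLocalRingPlaceDecomposition
open Summit.HodgeConjecture.HodgeConjecture.Cruxes.HLiu418.K2LiuRankOneStagePlaceLetterValues

variable (F : Type) [Field F] [NumberField F] (E : Type) [Field E] [NumberField E] [Algebra F E]
  [Algebra.IsQuadraticExtension F E] (c : E ≃ₐ[F] E)
  {δ : E} (hcδ : c δ = -δ) (hδ : δ ≠ 0) {d : F} (hd : δ * δ = algebraMap F E d) (v : HeightOneSpectrum (𝓞 F))
  {T₂ : Matrix (Fin 2) (Fin 2) F} (hT₂ : T₂.IsSymm) {J₂D : Matrix (Fin (2 + 2)) (Fin (2 + 2)) E} (hJ₂D : J₂D = (gramD F 2 T₂).map (algebraMap F E))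
  (D Dinv : Matrix (Fin 2) (Fin 2) F) (hDD : D * Dinv = 1) (hDD' : Dinv * D = 1) (Q : GL (Fin (2 + 2)) F)
  (hQm : (Q : Matrix (Fin (2 + 2)) (Fin (2 + 2)) F) = Matrix.reindex (e₂ 2) (e₂ 2) (Matrix.fromBlocks 1 D 1 (-D)))
  (hQ : (Q : Matrix (Fin (2 + 2)) (Fin (2 + 2)) F)ᵀ * gramD F 2 T₂ * (Q : Matrix (Fin (2 + 2)) (Fin (2 + 2)) F) = (StdForm.antidiagonal (2 + 2)).over F)

open Summit.HodgeConjecture.HodgeConjecture.Cruxes.HLiu418.K2LiuRankOneStageIntegralsAtHalf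

/-- **STAGE B ON `0 < re s₀` AT A SPLIT PLACE IS AN HONEST TRIPLE INTEGRAL OF `f s₀`** — from the (d′)(e′) letters of ★ `chainValues_of_placeLetter_pair` (types VERBATIM, `N₁ N₂`
abstract): `N₂ s₀ g = L_F(2s₀+1)⁻¹ · L_{E_{w₁}}(2s₀)⁻¹ · L_{E_{w₂}}(2s₀)⁻¹ · ∫_{ζ₁} ∫_{ζ₂} ∫_y f s₀ (φ(w₂)·φ(u_{2e₂}(ι y δ))·(φ(w₁)·φ(u⁻(ζ₁e_{w₁}+ζ₂e_{w₂}))·g)) dμF dμ₂ dμ₁` for EVERY `g`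
(linearity of the Bochner integral twice; no integrability needed). [cite: HarrisKudlaSweet1996, §6 (6.14)–(6.16)] [cite: Casselman1980, §3 Thm. 3.1] [cite: KudlaSweet1997, §1] -/
theorem stageB_eq_triple_integral_pair_of_pos_re
    (χv : ∀ w : PlacesOver E v, (w.1.adicCompletion E)ˣ →* ℂˣ)
    (f : ℂ → UnitaryGroup.localPi E c (2 + 2) J₂D v → ℂ) (w₁ w₂ : PlacesOver E v)
    [MeasurableSpace (v.adicCompletion F)] (μF : Measure (v.adicCompletion F))
    [MeasurableSpace (w₁.1.adicCompletion E)] (μ₁ : Measure (w₁.1.adicCompletion E))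
    [MeasurableSpace (w₂.1.adicCompletion E)] (μ₂ : Measure (w₂.1.adicCompletion E))
    (N₁ N₂ : ℂ → UnitaryGroup.localPi E c (2 + 2) J₂D v → ℂ)
    (hA : ∀ s : ℂ, (-1 : ℝ) / 2 < s.re → ∀ g : UnitaryGroup.localPi E c (2 + 2) J₂D v,
        Integrable (fun y => f s (FrameTransport.frameConj F E c v (2 + 2) hJ₂D (antidiagonal_over_eq_map F E 2) Q hQ (toLocalFour F E c v (weylTwo (UnitaryGroup.LocalRing E v) (UnitaryGroup.conjLocal E c v))) * FrameTransport.frameConj F E c v (2 + 2) hJ₂D (antidiagonal_over_eq_map F E 2) Q hQ (toLocalFour F E c v (uLongTwo (UnitaryGroup.LocalRing E v) (UnitaryGroup.conjLocal E c v) (UnitaryGroup.toLocalRing E v y * algebraMap E (UnitaryGroup.LocalRing E v) δ) (conjLocal_coord F E c hcδ v y))) * g)) μF ∧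
        N₁ s g = (lF F E v χv (2 * s + 1))⁻¹ * ∫ y, f s (FrameTransport.frameConj F E c v (2 + 2) hJ₂D (antidiagonal_over_eq_map F E 2) Q hQ (toLocalFour F E c v (weylTwo (UnitaryGroup.LocalRing E v) (UnitaryGroup.conjLocal E c v))) * FrameTransport.frameConj F E c v (2 + 2) hJ₂D (antidiagonal_over_eq_map F E 2) Q hQ (toLocalFour F E c v (uLongTwo (UnitaryGroup.LocalRing E v) (UnitaryGroup.conjLocal E c v) (UnitaryGroup.toLocalRing E v y * algebraMap E (UnitaryGroup.LocalRing E v) δ) (conjLocal_coord F E c hcδ v y))) * g) ∂μF)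
    (hB : ∀ s : ℂ, 0 < s.re → ∀ g : UnitaryGroup.localPi E c (2 + 2) J₂D v,
        N₂ s g = (lFactor E w₁.1 (chiNorm F E c v χv w₁) (2 * s))⁻¹ * ∫ ζ₁, (lFactor E w₂.1 (chiNorm F E c v χv w₂) (2 * s))⁻¹ *
          ∫ ζ₂, N₁ s (FrameTransport.frameConj F E c v (2 + 2) hJ₂D (antidiagonal_over_eq_map F E 2) Q hQ (toLocalFour F E c v (weylOne (UnitaryGroup.LocalRing E v) (UnitaryGroup.conjLocal E c v))) * FrameTransport.frameConj F E c v (2 + 2) hJ₂D (antidiagonal_over_eq_map F E 2) Q hQ (toLocalFour F E c v (uMinus (UnitaryGroup.LocalRing E v) (UnitaryGroup.conjLocal E c v) (UnitaryGroup.conjLocal_conjLocal c v hcδ hδ) (Pi.single w₁ ζ₁ + Pi.single w₂ ζ₂))) * g) ∂μ₂ ∂μ₁)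
    {s₀ : ℂ} (hs₀ : 0 < s₀.re) (g : UnitaryGroup.localPi E c (2 + 2) J₂D v) :
    N₂ s₀ g = (lF F E v χv (2 * s₀ + 1))⁻¹ * (lFactor E w₁.1 (chiNorm F E c v χv w₁) (2 * s₀))⁻¹ * (lFactor E w₂.1 (chiNorm F E c v χv w₂) (2 * s₀))⁻¹ *
      ∫ ζ₁, ∫ ζ₂, ∫ y, f s₀ (FrameTransport.frameConj F E c v (2 + 2) hJ₂D (antidiagonal_over_eq_map F E 2) Q hQ (toLocalFour F E c v (weylTwo (UnitaryGroup.LocalRing E v) (UnitaryGroup.conjLocal E c v))) * FrameTransport.frameConj F E c v (2 + 2) hJ₂D (antidiagonal_over_eq_map F E 2) Q hQ (toLocalFour F E c v (uLongTwo (UnitaryGroup.LocalRing E v) (UnitaryGroup.conjLocal E c v) (UnitaryGroup.toLocalRing E v y * algebraMap E (UnitaryGroup.LocalRing E v) δ) (conjLocal_coord F E c hcδ v y))) *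
        (FrameTransport.frameConj F E c v (2 + 2) hJ₂D (antidiagonal_over_eq_map F E 2) Q hQ (toLocalFour F E c v (weylOne (UnitaryGroup.LocalRing E v) (UnitaryGroup.conjLocal E c v))) * FrameTransport.frameConj F E c v (2 + 2) hJ₂D (antidiagonal_over_eq_map F E 2) Q hQ (toLocalFour F E c v (uMinus (UnitaryGroup.LocalRing E v) (UnitaryGroup.conjLocal E c v) (UnitaryGroup.conjLocal_conjLocal c v hcδ hδ) (Pi.single w₁ ζ₁ + Pi.single w₂ ζ₂))) * g)) ∂μF ∂μ₂ ∂μ₁ := by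
  obtain ⟨hm, -, -⟩ := re_facts_of_pos_re hs₀
  rw [hB s₀ hs₀ g]
  -- substitute stage A pointwise in `(ζ₁, ζ₂)` and pull its normalisation out of the two `ζ`-integrals
  have hinner : ∀ ζ₁ : w₁.1.adicCompletion E,
      ∫ ζ₂, N₁ s₀ (FrameTransport.frameConj F E c v (2 + 2) hJ₂D (antidiagonal_over_eq_map F E 2) Q hQ (toLocalFour F E c v (weylOne (UnitaryGroup.LocalRing E v) (UnitaryGroup.conjLocal E c v))) * FrameTransport.frameConj F E c v (2 + 2) hJ₂D (antidiagonal_over_eq_map F E 2) Q hQ (toLocalFour F E c v (uMinus (UnitaryGroup.LocalRing E v) (UnitaryGroup.conjLocal E c v) (UnitaryGroup.conjLocal_conjLocal c v hcδ hδ) (Pi.single w₁ ζ₁ + Pi.single w₂ ζ₂))) * g) ∂μ₂ =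
      (lF F E v χv (2 * s₀ + 1))⁻¹ * ∫ ζ₂, ∫ y, f s₀ (FrameTransport.frameConj F E c v (2 + 2) hJ₂D (antidiagonal_over_eq_map F E 2) Q hQ (toLocalFour F E c v (weylTwo (UnitaryGroup.LocalRing E v) (UnitaryGroup.conjLocal E c v))) * FrameTransport.frameConj F E c v (2 + 2) hJ₂D (antidiagonal_over_eq_map F E 2) Q hQ (toLocalFour F E c v (uLongTwo (UnitaryGroup.LocalRing E v) (UnitaryGroup.conjLocal E c v) (UnitaryGroup.toLocalRing E v y * algebraMap E (UnitaryGroup.LocalRing E v) δ) (conjLocal_coord F E c hcδ v y))) *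
        (FrameTransport.frameConj F E c v (2 + 2) hJ₂D (antidiagonal_over_eq_map F E 2) Q hQ (toLocalFour F E c v (weylOne (UnitaryGroup.LocalRing E v) (UnitaryGroup.conjLocal E c v))) * FrameTransport.frameConj F E c v (2 + 2) hJ₂D (antidiagonal_over_eq_map F E 2) Q hQ (toLocalFour F E c v (uMinus (UnitaryGroup.LocalRing E v) (UnitaryGroup.conjLocal E c v) (UnitaryGroup.conjLocal_conjLocal c v hcδ hδ) (Pi.single w₁ ζ₁ + Pi.single w₂ ζ₂))) * g)) ∂μF ∂μ₂ := by
    intro ζ₁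
    rw [← integral_const_mul]
    exact integral_congr_ae (Filter.Eventually.of_forall fun ζ₂ => (hA s₀ hm _).2)
  have houter : ∫ ζ₁, (lFactor E w₂.1 (chiNorm F E c v χv w₂) (2 * s₀))⁻¹ * ∫ ζ₂, N₁ s₀ (FrameTransport.frameConj F E c v (2 + 2) hJ₂D (antidiagonal_over_eq_map F E 2) Q hQ (toLocalFour F E c v (weylOne (UnitaryGroup.LocalRing E v) (UnitaryGroup.conjLocal E c v))) * FrameTransport.frameConj F E c v (2 + 2) hJ₂D (antidiagonal_over_eq_map F E 2) Q hQ (toLocalFour F E c v (uMinus (UnitaryGroup.LocalRing E v) (UnitaryGroup.conjLocal E c v) (UnitaryGroup.conjLocal_conjLocal c v hcδ hδ) (Pi.single w₁ ζ₁ + Pi.single w₂ ζ₂))) * g) ∂μ₂ ∂μ₁ =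
      ((lFactor E w₂.1 (chiNorm F E c v χv w₂) (2 * s₀))⁻¹ * (lF F E v χv (2 * s₀ + 1))⁻¹) * ∫ ζ₁, ∫ ζ₂, ∫ y, f s₀ (FrameTransport.frameConj F E c v (2 + 2) hJ₂D (antidiagonal_over_eq_map F E 2) Q hQ (toLocalFour F E c v (weylTwo (UnitaryGroup.LocalRing E v) (UnitaryGroup.conjLocal E c v))) * FrameTransport.frameConj F E c v (2 + 2) hJ₂D (antidiagonal_over_eq_map F E 2) Q hQ (toLocalFour F E c v (uLongTwo (UnitaryGroup.LocalRing E v) (UnitaryGroup.conjLocal E c v) (UnitaryGroup.toLocalRing E v y * algebraMap E (UnitaryGroup.LocalRing E v) δ) (conjLocal_coord F E c hcδ v y))) *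
        (FrameTransport.frameConj F E c v (2 + 2) hJ₂D (antidiagonal_over_eq_map F E 2) Q hQ (toLocalFour F E c v (weylOne (UnitaryGroup.LocalRing E v) (UnitaryGroup.conjLocal E c v))) * FrameTransport.frameConj F E c v (2 + 2) hJ₂D (antidiagonal_over_eq_map F E 2) Q hQ (toLocalFour F E c v (uMinus (UnitaryGroup.LocalRing E v) (UnitaryGroup.conjLocal E c v) (UnitaryGroup.conjLocal_conjLocal c v hcδ hδ) (Pi.single w₁ ζ₁ + Pi.single w₂ ζ₂))) * g)) ∂μF ∂μ₂ ∂μ₁ := by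
    rw [← integral_const_mul]
    refine integral_congr_ae (Filter.Eventually.of_forall fun ζ₁ => ?_)
    dsimp only
    rw [hinner ζ₁, mul_assoc]
  rw [houter]
  ring

/-- **STAGE B AT `s₀ = ½` AT A SPLIT PLACE**: `N₂ (1∕2) g = L_F(2)⁻¹ · L_{E_{w₁}}(1)⁻¹ · L_{E_{w₂}}(1)⁻¹ · ∫_{ζ₁} ∫_{ζ₂} ∫_y f (1∕2) (φ(w₂)·φ(u(yδ))·(φ(w₁)·φ(u⁻(ζ₁,ζ₂))·g)) dμF dμ₂ dμ₁`
for EVERY `g`. [cite: HarrisKudlaSweet1996, §6 (6.14)–(6.16)] [cite: Casselman1980, §3 Thm. 3.1] [cite: KudlaSweet1997, §1] -/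
theorem stageB_half_eq_triple_integral_pair
    (χv : ∀ w : PlacesOver E v, (w.1.adicCompletion E)ˣ →* ℂˣ)
    (f : ℂ → UnitaryGroup.localPi E c (2 + 2) J₂D v → ℂ) (w₁ w₂ : PlacesOver E v)
    [MeasurableSpace (v.adicCompletion F)] (μF : Measure (v.adicCompletion F))
    [MeasurableSpace (w₁.1.adicCompletion E)] (μ₁ : Measure (w₁.1.adicCompletion E))
    [MeasurableSpace (w₂.1.adicCompletion E)] (μ₂ : Measure (w₂.1.adicCompletion E))
    (N₁ N₂ : ℂ → UnitaryGroup.localPi E c (2 + 2) J₂D v → ℂ)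
    (hA : ∀ s : ℂ, (-1 : ℝ) / 2 < s.re → ∀ g : UnitaryGroup.localPi E c (2 + 2) J₂D v,
        Integrable (fun y => f s (FrameTransport.frameConj F E c v (2 + 2) hJ₂D (antidiagonal_over_eq_map F E 2) Q hQ (toLocalFour F E c v (weylTwo (UnitaryGroup.LocalRing E v) (UnitaryGroup.conjLocal E c v))) * FrameTransport.frameConj F E c v (2 + 2) hJ₂D (antidiagonal_over_eq_map F E 2) Q hQ (toLocalFour F E c v (uLongTwo (UnitaryGroup.LocalRing E v) (UnitaryGroup.conjLocal E c v) (UnitaryGroup.toLocalRing E v y * algebraMap E (UnitaryGroup.LocalRing E v) δ) (conjLocal_coord F E c hcδ v y))) * g)) μF ∧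
        N₁ s g = (lF F E v χv (2 * s + 1))⁻¹ * ∫ y, f s (FrameTransport.frameConj F E c v (2 + 2) hJ₂D (antidiagonal_over_eq_map F E 2) Q hQ (toLocalFour F E c v (weylTwo (UnitaryGroup.LocalRing E v) (UnitaryGroup.conjLocal E c v))) * FrameTransport.frameConj F E c v (2 + 2) hJ₂D (antidiagonal_over_eq_map F E 2) Q hQ (toLocalFour F E c v (uLongTwo (UnitaryGroup.LocalRing E v) (UnitaryGroup.conjLocal E c v) (UnitaryGroup.toLocalRing E v y * algebraMap E (UnitaryGroup.LocalRing E v) δ) (conjLocal_coord F E c hcδ v y))) * g) ∂μF)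
    (hB : ∀ s : ℂ, 0 < s.re → ∀ g : UnitaryGroup.localPi E c (2 + 2) J₂D v,
        N₂ s g = (lFactor E w₁.1 (chiNorm F E c v χv w₁) (2 * s))⁻¹ * ∫ ζ₁, (lFactor E w₂.1 (chiNorm F E c v χv w₂) (2 * s))⁻¹ *
          ∫ ζ₂, N₁ s (FrameTransport.frameConj F E c v (2 + 2) hJ₂D (antidiagonal_over_eq_map F E 2) Q hQ (toLocalFour F E c v (weylOne (UnitaryGroup.LocalRing E v) (UnitaryGroup.conjLocal E c v))) * FrameTransport.frameConj F E c v (2 + 2) hJ₂D (antidiagonal_over_eq_map F E 2) Q hQ (toLocalFour F E c v (uMinus (UnitaryGroup.LocalRing E v) (UnitaryGroup.conjLocal E c v) (UnitaryGroup.conjLocal_conjLocal c v hcδ hδ) (Pi.single w₁ ζ₁ + Pi.single w₂ ζ₂))) * g) ∂μ₂ ∂μ₁)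
    (g : UnitaryGroup.localPi E c (2 + 2) J₂D v) :
    N₂ (1 / 2) g = (lF F E v χv 2)⁻¹ * (lFactor E w₁.1 (chiNorm F E c v χv w₁) (2 * (1 / 2)))⁻¹ * (lFactor E w₂.1 (chiNorm F E c v χv w₂) (2 * (1 / 2)))⁻¹ *
      ∫ ζ₁, ∫ ζ₂, ∫ y, f (1 / 2) (FrameTransport.frameConj F E c v (2 + 2) hJ₂D (antidiagonal_over_eq_map F E 2) Q hQ (toLocalFour F E c v (weylTwo (UnitaryGroup.LocalRing E v) (UnitaryGroup.conjLocal E c v))) * FrameTransport.frameConj F E c v (2 + 2) hJ₂D (antidiagonal_over_eq_map F E 2) Q hQ (toLocalFour F E c v (uLongTwo (UnitaryGroup.LocalRing E v) (UnitaryGroup.conjLocal E c v) (UnitaryGroup.toLocalRing E v y * algebraMap E (UnitaryGroup.LocalRing E v) δ) (conjLocal_coord F E c hcδ v y))) *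
        (FrameTransport.frameConj F E c v (2 + 2) hJ₂D (antidiagonal_over_eq_map F E 2) Q hQ (toLocalFour F E c v (weylOne (UnitaryGroup.LocalRing E v) (UnitaryGroup.conjLocal E c v))) * FrameTransport.frameConj F E c v (2 + 2) hJ₂D (antidiagonal_over_eq_map F E 2) Q hQ (toLocalFour F E c v (uMinus (UnitaryGroup.LocalRing E v) (UnitaryGroup.conjLocal E c v) (UnitaryGroup.conjLocal_conjLocal c v hcδ hδ) (Pi.single w₁ ζ₁ + Pi.single w₂ ζ₂))) * g)) ∂μF ∂μ₂ ∂μ₁ := by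
  obtain ⟨h0, -, e1, -⟩ := half_re_facts
  rw [stageB_eq_triple_integral_pair_of_pos_re F E c hcδ hδ v hJ₂D Q hQ χv f w₁ w₂ μF μ₁ μ₂ N₁ N₂ hA hB h0 g, e1]

/-- **THE PLACE LETTER ON `0 < re s₀` AT A SPLIT PLACE IS `cN` TIMES THE QUADRUPLE CORNER INTEGRAL OF `f s₀`** — from (d′)(e′) and the pair ball clause (f′) of ★
`chainValues_of_placeLetter_pair` (types VERBATIM, (f′) for the one `h` at hand; `k₀` uniform in `s₀`):
`Gn′ s₀ h = cN · ∫_{x ∈ 𝔭^{−k}} conj ψ(σx) · ∫_{ζ₁} ∫_{ζ₂} ∫_y f s₀ (φ(w₂)·φ(u(yδ))·(φ(w₁)·φ(u⁻(ζ₁,ζ₂))·(φ(w₂)·φ(u(xδ))·h))) dμF dμ₂ dμ₁ dμF(x)` — the prefactor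
`L_F(2s₀+1)·L_{E_{w₂}}(2s₀)·L_{E_{w₁}}(2s₀)` CANCELS the (d′)(e′) normalisations (all non-zero for unitary `χ_v` on the half-planes).
[cite: HarrisKudlaSweet1996, §6 (6.14)–(6.16)] [cite: KudlaRallis1994, §2] [cite: KudlaSweet1997, §1] -/
theorem placeLetter_eq_corner_integral_pair_of_pos_re
    (χv : ∀ w : PlacesOver E v, (w.1.adicCompletion E)ˣ →* ℂˣ) (hχ : ∀ (w' : PlacesOver E v) (x : (w'.1.adicCompletion E)ˣ), ‖((χv w' x : ℂˣ) : ℂ)‖ = 1)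
    (f : ℂ → UnitaryGroup.localPi E c (2 + 2) J₂D v → ℂ)
    (ψ : AddChar (v.adicCompletion F) Circle) (σ : v.adicCompletion F) (w₁ w₂ : PlacesOver E v)
    [MeasurableSpace (v.adicCompletion F)] (μF : Measure (v.adicCompletion F))
    [MeasurableSpace (w₁.1.adicCompletion E)] (μ₁ : Measure (w₁.1.adicCompletion E))
    [MeasurableSpace (w₂.1.adicCompletion E)] (μ₂ : Measure (w₂.1.adicCompletion E))
    (cN : ℝ≥0) (N₁ N₂ : ℂ → UnitaryGroup.localPi E c (2 + 2) J₂D v → ℂ)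
    (hA : ∀ s : ℂ, (-1 : ℝ) / 2 < s.re → ∀ g : UnitaryGroup.localPi E c (2 + 2) J₂D v,
        Integrable (fun y => f s (FrameTransport.frameConj F E c v (2 + 2) hJ₂D (antidiagonal_over_eq_map F E 2) Q hQ (toLocalFour F E c v (weylTwo (UnitaryGroup.LocalRing E v) (UnitaryGroup.conjLocal E c v))) * FrameTransport.frameConj F E c v (2 + 2) hJ₂D (antidiagonal_over_eq_map F E 2) Q hQ (toLocalFour F E c v (uLongTwo (UnitaryGroup.LocalRing E v) (UnitaryGroup.conjLocal E c v) (UnitaryGroup.toLocalRing E v y * algebraMap E (UnitaryGroup.LocalRing E v) δ) (conjLocal_coord F E c hcδ v y))) * g)) μF ∧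
        N₁ s g = (lF F E v χv (2 * s + 1))⁻¹ * ∫ y, f s (FrameTransport.frameConj F E c v (2 + 2) hJ₂D (antidiagonal_over_eq_map F E 2) Q hQ (toLocalFour F E c v (weylTwo (UnitaryGroup.LocalRing E v) (UnitaryGroup.conjLocal E c v))) * FrameTransport.frameConj F E c v (2 + 2) hJ₂D (antidiagonal_over_eq_map F E 2) Q hQ (toLocalFour F E c v (uLongTwo (UnitaryGroup.LocalRing E v) (UnitaryGroup.conjLocal E c v) (UnitaryGroup.toLocalRing E v y * algebraMap E (UnitaryGroup.LocalRing E v) δ) (conjLocal_coord F E c hcδ v y))) * g) ∂μF)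
    (hB : ∀ s : ℂ, 0 < s.re → ∀ g : UnitaryGroup.localPi E c (2 + 2) J₂D v,
        N₂ s g = (lFactor E w₁.1 (chiNorm F E c v χv w₁) (2 * s))⁻¹ * ∫ ζ₁, (lFactor E w₂.1 (chiNorm F E c v χv w₂) (2 * s))⁻¹ *
          ∫ ζ₂, N₁ s (FrameTransport.frameConj F E c v (2 + 2) hJ₂D (antidiagonal_over_eq_map F E 2) Q hQ (toLocalFour F E c v (weylOne (UnitaryGroup.LocalRing E v) (UnitaryGroup.conjLocal E c v))) * FrameTransport.frameConj F E c v (2 + 2) hJ₂D (antidiagonal_over_eq_map F E 2) Q hQ (toLocalFour F E c v (uMinus (UnitaryGroup.LocalRing E v) (UnitaryGroup.conjLocal E c v) (UnitaryGroup.conjLocal_conjLocal c v hcδ hδ) (Pi.single w₁ ζ₁ + Pi.single w₂ ζ₂))) * g) ∂μ₂ ∂μ₁)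
    (Gn' : ℂ → UnitaryGroup.localPi E c (2 + 2) J₂D v → ℂ) (h : UnitaryGroup.localPi E c (2 + 2) J₂D v)
    (hball : ∃ k₀ : ℕ, ∀ s₀ : ℂ, 0 < s₀.re → ∀ k : ℕ, k₀ ≤ k →
        Gn' s₀ h = ((cN : ℝ) : ℂ) * lF F E v χv (2 * s₀ + 1) * lFactor E w₂.1 (chiNorm F E c v χv w₂) (2 * s₀) * lFactor E w₁.1 (chiNorm F E c v χv w₁) (2 * s₀) *
          ∫ x in primePowBall (v.adicCompletion F) (-(k : ℤ)), conj ((ψ (σ * x) : ℂ)) * N₂ s₀ (FrameTransport.frameConj F E c v (2 + 2) hJ₂D (antidiagonal_over_eq_map F E 2) Q hQ (toLocalFour F E c v (weylTwo (UnitaryGroup.LocalRing E v) (UnitaryGroup.conjLocal E c v))) * FrameTransport.frameConj F E c v (2 + 2) hJ₂D (antidiagonal_over_eq_map F E 2) Q hQ (toLocalFour F E c v (uLongTwo (UnitaryGroup.LocalRing E v) (UnitaryGroup.conjLocal E c v) (UnitaryGroup.toLocalRing E v x * algebraMap E (UnitaryGroup.LocalRing E v) δ) (conjLocal_coord F E c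 hcδ v x))) * h) ∂μF) :
    ∃ k₀ : ℕ, ∀ s₀ : ℂ, 0 < s₀.re → ∀ k : ℕ, k₀ ≤ k →
      Gn' s₀ h = ((cN : ℝ) : ℂ) *
        ∫ x in primePowBall (v.adicCompletion F) (-(k : ℤ)), conj ((ψ (σ * x) : ℂ)) *
          ∫ ζ₁, ∫ ζ₂, ∫ y, f s₀ (FrameTransport.frameConj F E c v (2 + 2) hJ₂D (antidiagonal_over_eq_map F E 2) Q hQ (toLocalFour F E c v (weylTwo (UnitaryGroup.LocalRing E v) (UnitaryGroup.conjLocal E c v))) * FrameTransport.frameConj F E c v (2 + 2) hJ₂D (antidiagonal_over_eq_map F E 2) Q hQ (toLocalFour F E c v (uLongTwo (UnitaryGroup.LocalRing E v) (UnitaryGroup.conjLocal E c v) (UnitaryGroup.toLocalRing E v y * algebraMap E (UnitaryGroup.LocalRing E v) δ) (conjLocal_coord F E c hcδ v y))) *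
            (FrameTransport.frameConj F E c v (2 + 2) hJ₂D (antidiagonal_over_eq_map F E 2) Q hQ (toLocalFour F E c v (weylOne (UnitaryGroup.LocalRing E v) (UnitaryGroup.conjLocal E c v))) * FrameTransport.frameConj F E c v (2 + 2) hJ₂D (antidiagonal_over_eq_map F E 2) Q hQ (toLocalFour F E c v (uMinus (UnitaryGroup.LocalRing E v) (UnitaryGroup.conjLocal E c v) (UnitaryGroup.conjLocal_conjLocal c v hcδ hδ) (Pi.single w₁ ζ₁ + Pi.single w₂ ζ₂))) *
              (FrameTransport.frameConj F E c v (2 + 2) hJ₂D (antidiagonal_over_eq_map F E 2) Q hQ (toLocalFour F E c v (weylTwo (UnitaryGroup.LocalRing E v) (UnitaryGroup.conjLocal E c v))) * FrameTransport.frameConj F E c v (2 + 2) hJ₂D (antidiagonal_over_eq_map F E 2) Q hQ (toLocalFour F E c v (uLongTwo (UnitaryGroup.LocalRing E v) (UnitaryGroup.conjLocal E c v) (UnitaryGroup.toLocalRing E v x * algebraMap E (UnitaryGroup.LocalRing E v) δ) (conjLocal_coord F E c hcδ v x))) * h))) ∂μF ∂μ₂ ∂μ₁ ∂μF := by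
  obtain ⟨k₀, hk₀⟩ := hball
  refine ⟨k₀, fun s₀ hs₀ k hk => ?_⟩
  obtain ⟨-, h₁, h₂⟩ := re_facts_of_pos_re hs₀
  rw [hk₀ s₀ hs₀ k hk]
  have hL₀ : lF F E v χv (2 * s₀ + 1) ≠ 0 := lF_ne_zero hχ h₁
  have hL₁ : lFactor E w₁.1 (chiNorm F E c v χv w₁) (2 * s₀) ≠ 0 := lFactor_ne_zero (norm_unramValue_le_one (norm_chiNorm_eq_one hχ w₁)) h₂
  have hL₂ : lFactor E w₂.1 (chiNorm F E c v χv w₂) (2 * s₀) ≠ 0 := lFactor_ne_zero (norm_unramValue_le_one (norm_chiNorm_eq_one hχ w₂)) h₂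
  have hpt : ∀ x : v.adicCompletion F,
      conj ((ψ (σ * x) : ℂ)) * N₂ s₀ (FrameTransport.frameConj F E c v (2 + 2) hJ₂D (antidiagonal_over_eq_map F E 2) Q hQ (toLocalFour F E c v (weylTwo (UnitaryGroup.LocalRing E v) (UnitaryGroup.conjLocal E c v))) * FrameTransport.frameConj F E c v (2 + 2) hJ₂D (antidiagonal_over_eq_map F E 2) Q hQ (toLocalFour F E c v (uLongTwo (UnitaryGroup.LocalRing E v) (UnitaryGroup.conjLocal E c v) (UnitaryGroup.toLocalRing E v x * algebraMap E (UnitaryGroup.LocalRing E v) δ) (conjLocal_coord F E c hcδ v x))) * h) =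
      ((lF F E v χv (2 * s₀ + 1))⁻¹ * (lFactor E w₁.1 (chiNorm F E c v χv w₁) (2 * s₀))⁻¹ * (lFactor E w₂.1 (chiNorm F E c v χv w₂) (2 * s₀))⁻¹) * (conj ((ψ (σ * x) : ℂ)) *
        ∫ ζ₁, ∫ ζ₂, ∫ y, f s₀ (FrameTransport.frameConj F E c v (2 + 2) hJ₂D (antidiagonal_over_eq_map F E 2) Q hQ (toLocalFour F E c v (weylTwo (UnitaryGroup.LocalRing E v) (UnitaryGroup.conjLocal E c v))) * FrameTransport.frameConj F E c v (2 + 2) hJ₂D (antidiagonal_over_eq_map F E 2) Q hQ (toLocalFour F E c v (uLongTwo (UnitaryGroup.LocalRing E v) (UnitaryGroup.conjLocal E c v) (UnitaryGroup.toLocalRing E v y * algebraMap E (UnitaryGroup.LocalRing E v) δ) (conjLocal_coord F E c hcδ v y))) *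
        (FrameTransport.frameConj F E c v (2 + 2) hJ₂D (antidiagonal_over_eq_map F E 2) Q hQ (toLocalFour F E c v (weylOne (UnitaryGroup.LocalRing E v) (UnitaryGroup.conjLocal E c v))) * FrameTransport.frameConj F E c v (2 + 2) hJ₂D (antidiagonal_over_eq_map F E 2) Q hQ (toLocalFour F E c v (uMinus (UnitaryGroup.LocalRing E v) (UnitaryGroup.conjLocal E c v) (UnitaryGroup.conjLocal_conjLocal c v hcδ hδ) (Pi.single w₁ ζ₁ + Pi.single w₂ ζ₂))) * (FrameTransport.frameConj F E c v (2 + 2) hJ₂D (antidiagonal_over_eq_map F E 2) Q hQ (toLocalFour F E c v (weylTwo (UnitaryGroup.LocalRing E v) (UnitaryGroup.conjLocal E c v))) * FrameTransport.frameConj F E c v (2 + 2) hJ₂D (antidiagonal_over_eq_map F E 2) Q hQ (toLocalFour F E c v (uLongTwo (UnitaryGroup.LocalRing E v) (UnitaryGroup.conjLocal E c v) (UnitaryGroup.toLocalRing E v x * algebraMap E (UnitaryGroup.LocalRing E v) δ) (conjLocal_coord F E c hcδ v x))) * h))) ∂μF ∂μ₂ ∂μ₁) := by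
    intro x
    rw [stageB_eq_triple_integral_pair_of_pos_re F E c hcδ hδ v hJ₂D Q hQ χv f w₁ w₂ μF μ₁ μ₂ N₁ N₂ hA hB hs₀]
    ring
  simp_rw [hpt]
  rw [integral_const_mul]
  field_simp

/-- **THE PLACE LETTER AT `s₀ = ½` AT A SPLIT PLACE**: for `k ≥ k₀(h)`,
`Gn′ (1∕2) h = cN · ∫_{x ∈ 𝔭^{−k}} conj ψ(σx) · ∫_{ζ₁} ∫_{ζ₂} ∫_y f (1∕2) (φ(w₂)·φ(u(yδ))·(φ(w₁)·φ(u⁻(ζ₁,ζ₂))·(φ(w₂)·φ(u(xδ))·h))) dμF dμ₂ dμ₁ dμF(x)` — no `L`-factor left.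
[cite: HarrisKudlaSweet1996, §6 (6.14)–(6.16)] [cite: KudlaRallis1994, §2] [cite: KudlaSweet1997, §1] -/
theorem placeLetter_half_eq_corner_integral_pair
    (χv : ∀ w : PlacesOver E v, (w.1.adicCompletion E)ˣ →* ℂˣ) (hχ : ∀ (w' : PlacesOver E v) (x : (w'.1.adicCompletion E)ˣ), ‖((χv w' x : ℂˣ) : ℂ)‖ = 1)
    (f : ℂ → UnitaryGroup.localPi E c (2 + 2) J₂D v → ℂ)
    (ψ : AddChar (v.adicCompletion F) Circle) (σ : v.adicCompletion F) (w₁ w₂ : PlacesOver E v)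
    [MeasurableSpace (v.adicCompletion F)] (μF : Measure (v.adicCompletion F))
    [MeasurableSpace (w₁.1.adicCompletion E)] (μ₁ : Measure (w₁.1.adicCompletion E))
    [MeasurableSpace (w₂.1.adicCompletion E)] (μ₂ : Measure (w₂.1.adicCompletion E))
    (cN : ℝ≥0) (N₁ N₂ : ℂ → UnitaryGroup.localPi E c (2 + 2) J₂D v → ℂ)
    (hA : ∀ s : ℂ, (-1 : ℝ) / 2 < s.re → ∀ g : UnitaryGroup.localPi E c (2 + 2) J₂D v,
        Integrable (fun y => f s (FrameTransport.frameConj F E c v (2 + 2) hJ₂D (antidiagonal_over_eq_map F E 2) Q hQ (toLocalFour F E c v (weylTwo (UnitaryGroup.LocalRing E v) (UnitaryGroup.conjLocal E c v))) * FrameTransport.frameConj F E c v (2 + 2) hJ₂D (antidiagonal_over_eq_map F E 2) Q hQ (toLocalFour F E c v (uLongTwo (UnitaryGroup.LocalRing E v) (UnitaryGroup.conjLocal E c v) (UnitaryGroup.toLocalRing E v y * algebraMap E (UnitaryGroup.LocalRing E v) δ) (conjLocal_coord F E c hcδ v y))) * g)) μF ∧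
        N₁ s g = (lF F E v χv (2 * s + 1))⁻¹ * ∫ y, f s (FrameTransport.frameConj F E c v (2 + 2) hJ₂D (antidiagonal_over_eq_map F E 2) Q hQ (toLocalFour F E c v (weylTwo (UnitaryGroup.LocalRing E v) (UnitaryGroup.conjLocal E c v))) * FrameTransport.frameConj F E c v (2 + 2) hJ₂D (antidiagonal_over_eq_map F E 2) Q hQ (toLocalFour F E c v (uLongTwo (UnitaryGroup.LocalRing E v) (UnitaryGroup.conjLocal E c v) (UnitaryGroup.toLocalRing E v y * algebraMap E (UnitaryGroup.LocalRing E v) δ) (conjLocal_coord F E c hcδ v y))) * g) ∂μF)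
    (hB : ∀ s : ℂ, 0 < s.re → ∀ g : UnitaryGroup.localPi E c (2 + 2) J₂D v,
        N₂ s g = (lFactor E w₁.1 (chiNorm F E c v χv w₁) (2 * s))⁻¹ * ∫ ζ₁, (lFactor E w₂.1 (chiNorm F E c v χv w₂) (2 * s))⁻¹ *
          ∫ ζ₂, N₁ s (FrameTransport.frameConj F E c v (2 + 2) hJ₂D (antidiagonal_over_eq_map F E 2) Q hQ (toLocalFour F E c v (weylOne (UnitaryGroup.LocalRing E v) (UnitaryGroup.conjLocal E c v))) * FrameTransport.frameConj F E c v (2 + 2) hJ₂D (antidiagonal_over_eq_map F E 2) Q hQ (toLocalFour F E c v (uMinus (UnitaryGroup.LocalRing E v) (UnitaryGroup.conjLocal E c v) (UnitaryGroup.conjLocal_conjLocal c v hcδ hδ) (Pi.single w₁ ζ₁ + Pi.single w₂ ζ₂))) * g) ∂μ₂ ∂μ₁)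
    (Gn' : ℂ → UnitaryGroup.localPi E c (2 + 2) J₂D v → ℂ) (h : UnitaryGroup.localPi E c (2 + 2) J₂D v)
    (hball : ∃ k₀ : ℕ, ∀ s₀ : ℂ, 0 < s₀.re → ∀ k : ℕ, k₀ ≤ k →
        Gn' s₀ h = ((cN : ℝ) : ℂ) * lF F E v χv (2 * s₀ + 1) * lFactor E w₂.1 (chiNorm F E c v χv w₂) (2 * s₀) * lFactor E w₁.1 (chiNorm F E c v χv w₁) (2 * s₀) *
          ∫ x in primePowBall (v.adicCompletion F) (-(k : ℤ)), conj ((ψ (σ * x) : ℂ)) * N₂ s₀ (FrameTransport.frameConj F E c v (2 + 2) hJ₂D (antidiagonal_over_eq_map F E 2) Q hQ (toLocalFour F E c v (weylTwo (UnitaryGroup.LocalRing E v) (UnitaryGroup.conjLocal E c v))) * FrameTransport.frameConj F E c v (2 + 2) hJ₂D (antidiagonal_over_eq_map F E 2) Q hQ (toLocalFour F E c v (uLongTwo (UnitaryGroup.LocalRing E v) (UnitaryGroup.conjLocal E c v) (UnitaryGroup.toLocalRing E v x * algebraMap E (UnitaryGroup.LocalRing E v) δ) (conjLocal_coord F E c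 hcδ v x))) * h) ∂μF) :
    ∃ k₀ : ℕ, ∀ k : ℕ, k₀ ≤ k →
      Gn' (1 / 2) h = ((cN : ℝ) : ℂ) *
        ∫ x in primePowBall (v.adicCompletion F) (-(k : ℤ)), conj ((ψ (σ * x) : ℂ)) *
          ∫ ζ₁, ∫ ζ₂, ∫ y, f (1 / 2) (FrameTransport.frameConj F E c v (2 + 2) hJ₂D (antidiagonal_over_eq_map F E 2) Q hQ (toLocalFour F E c v (weylTwo (UnitaryGroup.LocalRing E v) (UnitaryGroup.conjLocal E c v))) * FrameTransport.frameConj F E c v (2 + 2) hJ₂D (antidiagonal_over_eq_map F E 2) Q hQ (toLocalFour F E c v (uLongTwo (UnitaryGroup.LocalRing E v) (UnitaryGroup.conjLocal E c v) (UnitaryGroup.toLocalRing E v y * algebraMap E (UnitaryGroup.LocalRing E v) δ) (conjLocal_coord F E c hcδ v y))) *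
            (FrameTransport.frameConj F E c v (2 + 2) hJ₂D (antidiagonal_over_eq_map F E 2) Q hQ (toLocalFour F E c v (weylOne (UnitaryGroup.LocalRing E v) (UnitaryGroup.conjLocal E c v))) * FrameTransport.frameConj F E c v (2 + 2) hJ₂D (antidiagonal_over_eq_map F E 2) Q hQ (toLocalFour F E c v (uMinus (UnitaryGroup.LocalRing E v) (UnitaryGroup.conjLocal E c v) (UnitaryGroup.conjLocal_conjLocal c v hcδ hδ) (Pi.single w₁ ζ₁ + Pi.single w₂ ζ₂))) *
              (FrameTransport.frameConj F E c v (2 + 2) hJ₂D (antidiagonal_over_eq_map F E 2) Q hQ (toLocalFour F E c v (weylTwo (UnitaryGroup.LocalRing E v) (UnitaryGroup.conjLocal E c v))) * FrameTransport.frameConj F E c v (2 + 2) hJ₂D (antidiagonal_over_eq_map F E 2) Q hQ (toLocalFour F E c v (uLongTwo (UnitaryGroup.LocalRing E v) (UnitaryGroup.conjLocal E c v) (UnitaryGroup.toLocalRing E v x * algebraMap E (UnitaryGroup.LocalRing E v) δ) (conjLocal_coord F E c hcδ v x))) * h))) ∂μF ∂μ₂ ∂μ₁ ∂μF := by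
  obtain ⟨k₀, hk₀⟩ := placeLetter_eq_corner_integral_pair_of_pos_re F E c hcδ hδ v hJ₂D Q hQ χv hχ f ψ σ w₁ w₂ μF μ₁ μ₂ cN N₁ N₂ hA hB Gn' h hball
  exact ⟨k₀, fun k hk => hk₀ (1 / 2) half_re_facts.1 k hk⟩

end StageHalfSplit

end Summit.HodgeConjecture.HodgeConjecture.Cruxes.HLiu418.K2LiuRankOneStageIntegralsAtHalfSplit

end
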